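import Mathlib
import HarnessLib
import Literature.Analysis.FluidPDE.SelfSimilar
import Literature.Analysis.FluidPDE.TypeIAncientMild
import Literature.Probability.Distributions.GaussianSphereMarginal
import Summits.NavierStokesRegularity.NavierStokesRegularity.Theorems.QuarterLogPincerThinCascadeDefs
import Summits.NavierStokesRegularity.NavierStokesRegularity.Theorems.QuarterLogPincerTruncationEdgeAnatomyDefs

/-!
# Crux `QuarterLogPincer.TypeIQuantSubcubicExp` (stmt-NavierStokesRegularity-24077), EDGE line `truncation_edge` (ns-idea-7 g8/g9):
# **P3b′ ⇒ P3b BY NAME** — the author's PROVED profile integration (v1.7), with the explicit-constant cube-log budget (v1.2)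

Tree copy of the AUTHOR'S PROOFS (ns-idea-7 g9, workfile `Cruxes/TypeIQuantSubcubicExp/Lines/truncation_edge.lean` v1.7, VERBATIM:
section «T3 PROVED» — `integral_cube_mul_inv_add`, `envelopeCubeBudget_explicit` (cube-log budget of an enveloped field with the
explicit constant `3·|B₁|·A³`) — and section «v1.7 — P3b = P3b′ + PROVED profile integration» —
`supShadowingLocal_of_profile : SupShadowingProfile v → SupShadowingLocal v`, `stubSupShadowingLocal_of_profile`), re-homed by the
pub-ns-dss typer (g35; `--supports stmt-NavierStokesRegularity-24077`, helper) over the re-homed objects of `…TruncationEdgeAnatomyDefs`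
(`SupShadowingProfile`, `StubSupShadowingProfile` appended there, v1.7 verbatim).  (The registered-shape `envelopeCubeBudget_of_hasTypeIDecay`
is NOT repeated here: it is landed in `…TypeIQuantSubcubicExpTruncationEdgeEnvelopeCubeBudget`, p660348.)  Credit: ns-idea-7 g9; nothing
changed except this header.

After this file and `…CutoffData` (P1), `…FrameBootstrap` (P2), `…SupShadowingCore` (P3a), `…ExteriorCube` (P4), the T1 anatomy in
`Theorems/` is complete EXCEPT the one analytic piece **P3b′ `StubSupShadowingProfile`** (pointwise outer profile `K/ρ + K/(‖x‖+1)` of the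
difference; author's sizing M–L).  HONEST FRAME: glue about hypothetical objects; T1, 24077, 22144, W7 and NS regularity OPEN / not proved.
-/

noncomputable section

-- the summit-side namespace repeats a component by design (D-0017)
set_option linter.dupNamespace false

namespace Summit.NavierStokesRegularity.NavierStokesRegularity.Cruxes.TypeIQuantSubcubicExp.TruncationEdge

open MeasureTheory Set Function Metric Filter Topology
open scoped ENNReal NNReal
open Literature.Analysis Literature.Analysis.FluidPDE
open Summit.NavierStokesRegularity.NavierStokesRegularity.Cruxes.TypeIQuantSubcubicExp.ThinCascade

/-! ### The explicit-constant cube-log budget (author's v1.2 section, verbatim) -/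

/-- The one-dimensional integral behind the cube-log budget:
`∫_{0<y<R} A³/(y+δ) dy = A³ (log (R+δ) − log δ)`. [folklore] -/
theorem integral_cube_mul_inv_add (A δ R : ℝ) (hδ : 0 < δ) (hR : 0 ≤ R) :
    ∫ y in Ioo 0 R, A ^ 3 * (1 / (y + δ)) = A ^ 3 * (Real.log (R + δ) - Real.log δ) := by
  have hIoo : ∫ y in Ioo 0 R, A ^ 3 * (1 / (y + δ)) = ∫ y in (0 : ℝ)..R, A ^ 3 * (1 / (y + δ)) := by
    rw [intervalIntegral.integral_of_le hR, integral_Ioc_eq_integral_Ioo]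
  rw [hIoo, intervalIntegral.integral_const_mul]
  congr 1
  have hderiv : ∀ y ∈ uIcc (0 : ℝ) R, HasDerivAt (fun y => Real.log (y + δ)) (1 / (y + δ)) y := by
    intro y hy
    rw [uIcc_of_le hR] at hy
    have hpos : y + δ ≠ 0 := by linarith [hy.1]
    have h := ((hasDerivAt_id y).add_const δ).log hpos
    simpa using h
  have hcont : ContinuousOn (fun y : ℝ => 1 / (y + δ)) (uIcc 0 R) := by
    rw [uIcc_of_le hR]
    refine ContinuousOn.div continuousOn_const (continuousOn_id.add continuousOn_const) ?_
    intro y hy; exact ne_of_gt (by linarith [hy.1])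
  have hint : IntervalIntegrable (fun y : ℝ => 1 / (y + δ)) volume 0 R :=
    hcont.intervalIntegrable
  rw [intervalIntegral.integral_eq_sub_of_hasDerivAt hderiv hint]
  simp

/-- **T3 (cube-log budget of an enveloped field), PROVED (v1.2).**  If `‖v(s,x)‖ ≤ A/(‖x‖ + √(−s))` for
`s < 0`, then with `B = 3·|B₁|·A³`: for `R ≥ 2`, `ε ∈ (0,1]` there is `b ≥ 0` with
`b³ ≤ B (1 + log R + log (1/ε))` and `‖1_{B(0,R)} v(s)‖_{L³} ≤ b` for all `s ∈ [−1, −ε]`.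
Polar coordinates (`Literature.Probability.Distributions.lintegral_fun_norm_addHaar`) and `y²/(y+δ)³ ≤ 1/(y+δ)`.
[this file; line theorem] -/
theorem envelopeCubeBudget_explicit {A : ℝ}
    {v : ℝ → EuclideanSpace ℝ (Fin 3) → EuclideanSpace ℝ (Fin 3)}
    (hA : 0 ≤ A) (hdec : HasTypeIDecay A v) :
    ∀ R : ℝ, 2 ≤ R → ∀ ε ∈ Set.Ioc (0 : ℝ) 1, ∃ b : ℝ, 0 ≤ b ∧
      b ^ 3 ≤ 3 * (volume (Metric.ball (0 : EuclideanSpace ℝ (Fin 3)) 1)).toReal * A ^ 3 *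
        (1 + Real.log R + Real.log (1 / ε)) ∧
      ∀ s ∈ Set.Icc (-1 : ℝ) (-ε),
        eLpNorm ((Metric.ball (0 : EuclideanSpace ℝ (Fin 3)) R).indicator (v s)) 3 volume ≤
          ENNReal.ofReal b := by
  -- the volume of the unit ball (finite) and the constant
  set V : ℝ := (volume (ball (0 : EuclideanSpace ℝ (Fin 3)) 1)).toReal with hVdef
  have hVfin : volume (ball (0 : EuclideanSpace ℝ (Fin 3)) 1) ≠ ⊤ := measure_ball_lt_top.ne
  have hV0 : 0 ≤ V := ENNReal.toReal_nonneg
  have hVeq : volume (ball (0 : EuclideanSpace ℝ (Fin 3)) 1) = ENNReal.ofReal V := by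
    rw [hVdef, ENNReal.ofReal_toReal hVfin]
  intro R hR ε hε
  obtain ⟨hε0, hε1⟩ := hε
  set L : ℝ := 1 + Real.log R + Real.log (1 / ε) with hLdef
  have hlogR : 0 ≤ Real.log R := Real.log_nonneg (by linarith)
  have hlogε : 0 ≤ Real.log (1 / ε) := Real.log_nonneg (by rw [le_div_iff₀ hε0]; linarith)
  have hL1 : 1 ≤ L := by linarith
  have hBL : 0 ≤ 3 * V * A ^ 3 * L := by positivity
  -- the level
  set b : ℝ := (3 * V * A ^ 3 * L) ^ ((3 : ℕ)⁻¹ : ℝ) with hbdef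
  have hb0 : 0 ≤ b := Real.rpow_nonneg hBL _
  have hb3 : b ^ 3 = 3 * V * A ^ 3 * L := Real.rpow_inv_natCast_pow hBL (by norm_num)
  refine ⟨b, hb0, le_of_eq hb3, ?_⟩
  intro s hs
  obtain ⟨hs1, hs2⟩ := hs
  have hsneg : s < 0 := by linarith
  have hms : 0 < -s := by linarith
  set δ : ℝ := Real.sqrt (-s) with hδdef
  have hδ0 : 0 < δ := Real.sqrt_pos.2 hms
  have hδ1 : δ ≤ 1 := by
    rw [hδdef]
    calc Real.sqrt (-s) ≤ Real.sqrt 1 := Real.sqrt_le_sqrt (by linarith)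
      _ = 1 := Real.sqrt_one
  -- (1) the radial majorant
  set f : ℝ → ℝ≥0∞ := (Iio R).indicator fun r => ENNReal.ofReal ((A / (r + δ)) ^ 3) with hfdef
  have hfm : Measurable f := by
    refine Measurable.indicator ?_ measurableSet_Iio
    exact ENNReal.measurable_ofReal.comp
      ((measurable_const.div (measurable_id.add_const δ)).pow_const 3)
  have hptw : ∀ x : EuclideanSpace ℝ (Fin 3),
      ‖(ball (0 : EuclideanSpace ℝ (Fin 3)) R).indicator (v s) x‖ₑ ^ (3 : ℝ) ≤ f ‖x‖ := by
    intro x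
    by_cases hx : x ∈ ball (0 : EuclideanSpace ℝ (Fin 3)) R
    · have hxR : ‖x‖ ∈ Iio R := by simpa using hx
      rw [indicator_of_mem hx, hfdef, indicator_of_mem hxR, ← ofReal_norm,
        ENNReal.ofReal_rpow_of_nonneg (norm_nonneg _) (by norm_num)]
      refine ENNReal.ofReal_le_ofReal ?_
      have h1 : ‖v s x‖ ≤ A / (‖x‖ + δ) := hdec s hsneg x
      have h2 : ‖v s x‖ ^ (3 : ℝ) = ‖v s x‖ ^ (3 : ℕ) := by
        rw [show (3 : ℝ) = ((3 : ℕ) : ℝ) by norm_num, Real.rpow_natCast]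
      rw [h2]
      exact pow_le_pow_left₀ (norm_nonneg _) h1 3
    · rw [indicator_of_notMem hx]
      simp
  -- (2) polar coordinates
  have hfr : Module.finrank ℝ (EuclideanSpace ℝ (Fin 3)) = 3 := by simp
  have hpolar := Literature.Probability.Distributions.lintegral_fun_norm_addHaar
    (volume : Measure (EuclideanSpace ℝ (Fin 3))) f hfm
  rw [hfr] at hpolar
  -- (3) the one-dimensional bound: `y² f(y) ≤ 1_{(0,R)} A³/(y+δ)` on `y > 0`
  set g : ℝ → ℝ := fun y => A ^ 3 * (1 / (y + δ)) with hgdef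
  have hg1 : ∀ y ∈ Ioi (0 : ℝ),
      ENNReal.ofReal (y ^ (3 - 1)) * f y ≤ (Ioo 0 R).indicator (fun y => ENNReal.ofReal (g y)) y := by
    intro y hy
    rw [mem_Ioi] at hy
    by_cases hyR : y < R
    · have hyI : y ∈ Iio R := hyR
      have hyo : y ∈ Ioo 0 R := ⟨hy, hyR⟩
      rw [hfdef, indicator_of_mem hyI, indicator_of_mem hyo, ← ENNReal.ofReal_mul (by positivity)]
      refine ENNReal.ofReal_le_ofReal ?_
      have hyd : 0 < y + δ := by linarith
      rw [hgdef, div_pow, show (3 - 1 : ℕ) = 2 by norm_num]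
      -- y² · A³/(y+δ)³ ≤ A³/(y+δ)
      rw [show y ^ 2 * (A ^ 3 / (y + δ) ^ 3) = A ^ 3 * (y ^ 2 / (y + δ) ^ 3) by ring]
      refine mul_le_mul_of_nonneg_left ?_ (by positivity)
      rw [div_le_div_iff₀ (by positivity) hyd]
      have : y ^ 2 ≤ (y + δ) ^ 2 := by nlinarith
      nlinarith [this, hyd]
    · have hyI : y ∉ Iio R := hyR
      rw [hfdef, indicator_of_notMem hyI]
      simp
  -- integrability of `g` on `(0, R)`
  have hR0 : 0 ≤ R := by linarith
  have hgcont : ContinuousOn g (Icc 0 R) := by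
    refine ContinuousOn.mul continuousOn_const ?_
    refine ContinuousOn.div continuousOn_const (continuousOn_id.add continuousOn_const) ?_
    intro y hy; exact ne_of_gt (by linarith [hy.1])
  have hgint : IntegrableOn g (Ioo 0 R) volume :=
    (hgcont.integrableOn_Icc).mono_set Ioo_subset_Icc_self
  have hgnn : 0 ≤ᵐ[volume.restrict (Ioo 0 R)] g := by
    filter_upwards [ae_restrict_mem measurableSet_Ioo] with y hy
    have : 0 < y + δ := by linarith [hy.1]
    rw [hgdef]; positivity
  -- (4) assemble the bound on the cube integral
  have hcube : ∫⁻ x, ‖(ball (0 : EuclideanSpace ℝ (Fin 3)) R).indicator (v s) x‖ₑ ^ (3 : ℝ) ∂volume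
      ≤ ENNReal.ofReal (3 * V * A ^ 3 * L) := by
    calc ∫⁻ x, ‖(ball (0 : EuclideanSpace ℝ (Fin 3)) R).indicator (v s) x‖ₑ ^ (3 : ℝ) ∂volume
        ≤ ∫⁻ x, f ‖x‖ ∂volume := lintegral_mono hptw
      _ = 3 * volume (ball (0 : EuclideanSpace ℝ (Fin 3)) 1) *
            ∫⁻ y in Ioi (0 : ℝ), ENNReal.ofReal (y ^ (3 - 1)) * f y := by
          rw [hpolar]; norm_cast
      _ ≤ 3 * volume (ball (0 : EuclideanSpace ℝ (Fin 3)) 1) *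
            ∫⁻ y in Ioi (0 : ℝ), (Ioo 0 R).indicator (fun y => ENNReal.ofReal (g y)) y := by
          exact mul_le_mul_right (setLIntegral_mono' measurableSet_Ioi hg1) _
      _ ≤ 3 * volume (ball (0 : EuclideanSpace ℝ (Fin 3)) 1) *
            ∫⁻ y, (Ioo 0 R).indicator (fun y => ENNReal.ofReal (g y)) y ∂volume := by
          gcongr
          exact Measure.restrict_le_self
      _ = 3 * volume (ball (0 : EuclideanSpace ℝ (Fin 3)) 1) *
            ENNReal.ofReal (∫ y in Ioo 0 R, g y) := by
          rw [lintegral_indicator measurableSet_Ioo, ofReal_integral_eq_lintegral_ofReal hgint hgnn]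
      _ = ENNReal.ofReal (3 * V * (A ^ 3 * (Real.log (R + δ) - Real.log δ))) := by
          rw [hgdef, integral_cube_mul_inv_add A δ R hδ0 hR0, hVeq, ← ENNReal.ofReal_ofNat,
            ← ENNReal.ofReal_mul (by norm_num), ← ENNReal.ofReal_mul (by positivity)]
      _ ≤ ENNReal.ofReal (3 * V * A ^ 3 * L) := by
          refine ENNReal.ofReal_le_ofReal ?_
          have hlog1 : Real.log (R + δ) ≤ Real.log 2 + Real.log R := by
            rw [← Real.log_mul (by norm_num) (by linarith)]
            exact Real.log_le_log (by linarith) (by linarith)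
          have hlog2 : -Real.log δ ≤ Real.log (1 / ε) := by
            rw [hδdef, Real.log_sqrt hms.le, one_div, Real.log_inv]
            have : Real.log ε ≤ Real.log (-s) := Real.log_le_log hε0 (by linarith)
            have hε' : Real.log ε ≤ 0 := Real.log_nonpos hε0.le hε1
            linarith
          have hlog3 : Real.log 2 < 1 := by
            have := Real.log_two_lt_d9; linarith
          have hdiff : Real.log (R + δ) - Real.log δ ≤ L := by rw [hLdef]; linarith
          have hVA : 0 ≤ 3 * V * A ^ 3 := by positivity
          nlinarith [hdiff, hVA]
  -- (5) from the cube integral to the `L³` norm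
  rw [eLpNorm_eq_lintegral_rpow_enorm_toReal (by norm_num) (by norm_num)]
  simp only [ENNReal.toReal_ofNat, one_div]
  calc (∫⁻ x, ‖(ball (0 : EuclideanSpace ℝ (Fin 3)) R).indicator (v s) x‖ₑ ^ (3 : ℝ) ∂volume) ^ (3 : ℝ)⁻¹
      ≤ (ENNReal.ofReal (3 * V * A ^ 3 * L)) ^ (3 : ℝ)⁻¹ := by gcongr
    _ = ENNReal.ofReal b := by
        rw [ENNReal.ofReal_rpow_of_nonneg hBL (by norm_num), hbdef]
        norm_num


/-! ### P3b′ ⇒ P3b: profile integration (author's v1.7 section, verbatim) -/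

/-- **Profile integration, PROVED**: the pointwise profile `K/ρ + K/(‖x‖+1)` on the ball `B̄(0,2ρ)`
is dominated by the single envelope `4K/(‖x‖+1)` (as `‖x‖ + 1 ≤ 3ρ` there), whose localised cube is
log-shaped by the T3 computation `envelopeCubeBudget_of_hasTypeIDecay` applied to the frozen field
`s ↦ 1_{s=−1} · 1_{B̄(2ρ)} w(t)`. Hence P3b′ ⇒ P3b. [this file; line object — glue] -/
theorem supShadowingLocal_of_profile {v : ℝ → EuclideanSpace ℝ (Fin 3) → EuclideanSpace ℝ (Fin 3)}
    (hP : SupShadowingProfile v) : SupShadowingLocal v := by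
  intro K₀ hK₀
  obtain ⟨δ₀, ρ₁, K, hδ₀, hδ₀1, hρ₁, hK, hprof⟩ := hP K₀ hK₀
  -- the T3 constant for the envelope `4K/(‖x‖ + √(−s))`
  set V : ℝ := (volume (ball (0 : EuclideanSpace ℝ (Fin 3)) 1)).toReal with hVdef
  have hV0 : 0 ≤ V := ENNReal.toReal_nonneg
  -- output constants
  refine ⟨δ₀, ρ₁, max (2 * K) (2 * (3 * V * (4 * K) ^ 3)), hδ₀, hδ₀1, hρ₁,
    le_max_of_le_left (by positivity), ?_⟩
  intro δ' hδ' hδ'δ₀ ρ hρ hK₀ρ u₀ hu₀ T' hT' u p hfr hu0 hclose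
  have hρpos : 0 < ρ := by linarith
  have hpt := hprof δ' hδ' hδ'δ₀ ρ hρ hK₀ρ u₀ hu₀ T' hT' u p hfr hu0 hclose
  refine ⟨fun t ht x hx => ?_, ?_⟩
  · -- (c): outer smallness
    have h1 : K / (‖x‖ + 1) ≤ K / ρ :=
      div_le_div_of_nonneg_left hK hρpos (by linarith)
    calc ‖u t x - v (t - 1) x‖ ≤ K / ρ + K / (‖x‖ + 1) := hpt t ht x
      _ ≤ K / ρ + K / ρ := by linarith
      _ = 2 * K / ρ := by ring
      _ ≤ max (2 * K) (2 * (3 * V * (4 * K) ^ 3)) / ρ :=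
          div_le_div_of_nonneg_right (le_max_left _ _) hρpos.le
  · -- (b): the log-shaped cube via T3 on the frozen, localised field
    set Q : ℝ := 3 * V * (4 * K) ^ 3 * (1 + Real.log (2 * ρ)) with hQ_def
    have hlog2ρ : 0 ≤ Real.log (2 * ρ) := Real.log_nonneg (by linarith)
    have hQ0 : 0 ≤ Q := by positivity
    refine ⟨Q ^ (1 / 3 : ℝ), by positivity, ?_, fun t ht => ?_⟩
    · rw [show (Q ^ (1 / 3 : ℝ)) ^ 3 = Q by rw [← Real.rpow_natCast, ← Real.rpow_mul hQ0]; norm_num, hQ_def]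
      have hlog2 : Real.log (2 * ρ) ≤ 1 + Real.log ρ := by
        rw [Real.log_mul two_ne_zero hρpos.ne']
        have : Real.log 2 ≤ 1 := by
          have := Real.log_two_lt_d9; norm_num at this; linarith
        linarith
      have hlogρ : 0 ≤ Real.log ρ := Real.log_nonneg (by linarith)
      calc 3 * V * (4 * K) ^ 3 * (1 + Real.log (2 * ρ))
          ≤ 3 * V * (4 * K) ^ 3 * (2 * (1 + Real.log ρ)) :=
            mul_le_mul_of_nonneg_left (by linarith) (by positivity)
        _ = 2 * (3 * V * (4 * K) ^ 3) * (1 + Real.log ρ) := by ring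
        _ ≤ max (2 * K) (2 * (3 * V * (4 * K) ^ 3)) * (1 + Real.log ρ) :=
            mul_le_mul_of_nonneg_right (le_max_right _ _) (by linarith)
    · -- the frozen field
      set B : Set (EuclideanSpace ℝ (Fin 3)) := closedBall 0 (2 * ρ) with hB_def
      set W : ℝ → EuclideanSpace ℝ (Fin 3) → EuclideanSpace ℝ (Fin 3) :=
        fun s x => if s = -1 then B.indicator (fun y => u t y - v (t - 1) y) x else 0 with hW_def
      have hWdec : HasTypeIDecay (4 * K) W := by
        intro s hs x
        by_cases hs1 : s = -1
        · have hW : W s x = B.indicator (fun y => u t y - v (t - 1) y) x := by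
            simp only [hW_def, hs1, if_true]
          rw [hW, hs1, neg_neg, Real.sqrt_one]
          by_cases hxB : x ∈ B
          · rw [indicator_of_mem hxB]
            have hx2ρ : ‖x‖ ≤ 2 * ρ := mem_closedBall_zero_iff.1 hxB
            have hxpos : 0 < ‖x‖ + 1 := by positivity
            have h1 : K / ρ ≤ 3 * K / (‖x‖ + 1) := by
              rw [div_le_div_iff₀ hρpos hxpos]; nlinarith
            calc ‖u t x - v (t - 1) x‖ ≤ K / ρ + K / (‖x‖ + 1) := hpt t ht x
              _ ≤ 3 * K / (‖x‖ + 1) + K / (‖x‖ + 1) := by linarith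
              _ = 4 * K / (‖x‖ + 1) := by ring
          · rw [indicator_of_notMem hxB, norm_zero]; positivity
        · have hW : W s x = 0 := by simp only [hW_def, hs1, if_false]
          rw [hW, norm_zero]
          have : 0 < ‖x‖ + Real.sqrt (-s) := by
            have := Real.sqrt_pos.2 (show 0 < -s by linarith); positivity
          positivity
      have h2ρ : (2 : ℝ) ≤ 2 * ρ := by linarith
      obtain ⟨b, hb0, hb3, hbs⟩ := envelopeCubeBudget_explicit (by positivity : (0 : ℝ) ≤ 4 * K) hWdec
        (2 * ρ) h2ρ 1 ⟨one_pos, le_rfl⟩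
      have hb3' : b ^ 3 ≤ Q := by simpa [hQ_def, hVdef] using hb3
      have hbQ : b ≤ Q ^ (1 / 3 : ℝ) := by
        have h := Real.rpow_le_rpow (by positivity : (0 : ℝ) ≤ b ^ 3) hb3' (by norm_num : (0 : ℝ) ≤ 1 / 3)
        rwa [← Real.rpow_natCast, ← Real.rpow_mul hb0, show ((3 : ℕ) : ℝ) * (1 / 3) = 1 by norm_num,
          Real.rpow_one] at h
      have hs1 : (-1 : ℝ) ∈ Icc (-1 : ℝ) (-1) := ⟨le_rfl, le_rfl⟩
      have hball := hbs (-1) hs1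
      have hW1 : W (-1) = B.indicator (fun y => u t y - v (t - 1) y) := by
        funext x; simp only [hW_def, if_true]
      rw [hW1, indicator_indicator, show ball (0 : EuclideanSpace ℝ (Fin 3)) (2 * ρ) ∩ B =
        ball (0 : EuclideanSpace ℝ (Fin 3)) (2 * ρ) from
          inter_eq_left.2 ball_subset_closedBall] at hball
      -- closed ball versus open ball: the sphere is null
      have hae : B.indicator (fun x => u t x - v (t - 1) x) =ᵐ[volume]
          (Metric.ball (0 : EuclideanSpace ℝ (Fin 3)) (2 * ρ)).indicator (fun x => u t x - v (t - 1) x) := by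
        have hnull : volume (Metric.sphere (0 : EuclideanSpace ℝ (Fin 3)) (2 * ρ)) = 0 :=
          Measure.addHaar_sphere volume 0 (2 * ρ)
        have hsub : {x | B.indicator (fun x => u t x - v (t - 1) x) x ≠
            (Metric.ball (0 : EuclideanSpace ℝ (Fin 3)) (2 * ρ)).indicator
              (fun x => u t x - v (t - 1) x) x} ⊆
            Metric.sphere (0 : EuclideanSpace ℝ (Fin 3)) (2 * ρ) := by
          intro x hx
          by_contra hxs
          apply hx
          by_cases hxb : x ∈ Metric.ball (0 : EuclideanSpace ℝ (Fin 3)) (2 * ρ)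
          · have hxB : x ∈ B := Metric.ball_subset_closedBall hxb
            simp [Set.indicator_of_mem hxB, Set.indicator_of_mem hxb]
          · have hxB : x ∉ B := by
              intro hxB
              apply hxs
              rw [Metric.mem_sphere]
              have h1 : dist x 0 ≤ 2 * ρ := Metric.mem_closedBall.1 hxB
              have h2 : 2 * ρ ≤ dist x 0 := not_lt.1 fun h => hxb (Metric.mem_ball.2 h)
              linarith
            simp [Set.indicator_of_notMem hxB, Set.indicator_of_notMem hxb]
        exact measure_mono_null hsub hnull
      rw [eLpNorm_congr_ae hae]
      exact hball.trans (ENNReal.ofReal_le_ofReal hbQ)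

/-- **P3b from P3b′** for the registered closed forms. [this file; line object — glue] -/
theorem stubSupShadowingLocal_of_profile (h : StubSupShadowingProfile) : StubSupShadowingLocal :=
  fun M A v hv hA => supShadowingLocal_of_profile (h M A v hv hA)


end Summit.NavierStokesRegularity.NavierStokesRegularity.Cruxes.TypeIQuantSubcubicExp.TruncationEdge

end
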